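import Literature.AnabelianGeometry.SemiGraphs.TemperedReconstructionVertexMapProofs
import Literature.AnabelianGeometry.SemiGraphs.TemperedCompactInVerticialAt
import HarnessLib

/-!
# Semi-graphs of anabelioids, §3: Corollary 3.9 — the vertex map of a quasi-geometric morphism, AT ONE PAIR OF GRAPHS

Mochizuki, *Semi-graphs of anabelioids*, Publ. RIMS **42** (2006), §3, Corollary 3.9, proof, manuscript
p. 42 [cite: MochizukiSemiAnbd2006, Cor 3.9 p.42]: "any quasi-geometric morphism
`φ : B^temp(G) → B^temp(H)` induces a map from the vertices of `G` to the vertices of `H` [i.e., by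
considering the unique [conjugacy class of] verticial subgroup(s) of `π₁^temp(H)` that contain(s) the
image of a given verticial subgroup of `π₁^temp(G)`; here, we apply Proposition 3.2; Definition 3.8;
Theorem 3.7, (ii), (iii)]."

PROOF-ONLY companion (abc-iut cell, L3-lead ruling α4-3 «φ2-CONSUMERS», block B0b, seat abc-iut-L3-d1)
of `TemperedReconstructionVertexMapProofs.lean` (abc-iut-L3-t2): the SAME proof of
`existsUnique_vertexMap_of_isQuasiGeometric`, with the ∀-countable named fact
`MaximalCompactIffVerticial` (Thm. 3.7 (iv)) replaced by its per-graph form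
`MaximalCompactIffVerticialAt` (`TemperedCompactInVerticialAt.lean`, abc-iut-w4-d075) at the two graphs
`𝒢`, `ℋ` where the proof instantiates it.  Port rule (α4-3): `(h37iv : MaximalCompactIffVerticial)` ↦
`(h37iv𝒢 : MaximalCompactIffVerticialAt 𝒢) (h37ivℋ : MaximalCompactIffVerticialAt ℋ)`,
`h37iv X hX c ↦ h37ivX hX c`, decl suffix `_at`; everything else verbatim; the original is untouched
(its `vertex_eq_of_mapsOnto_of_le`, over the PROVED Thm. 3.7 (ii), is reused by name).
Nothing here takes a side on [IUTchIII] Cor. 3.12; typed ≠ discharged.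
-/

open CategoryTheory Topology

namespace Literature.AnabelianGeometry.SemiGraphs

namespace ProfiniteSemiGraph

universe u

variable {𝒢 ℋ : ProfiniteSemiGraph.{u}}

/-- **A quasi-geometric `φ` determines the map on vertices, from Thm. 3.7 (iv) AT `𝒢` and AT `ℋ`**
([SemiAnbd] Cor. 3.9, proof, p. 42), with Thm. 3.7 (i), (ii): there is a unique `f_V : V(G) → V(H)`
such that every verticial subgroup of `π₁^temp(G)` at `v` maps onto an open subgroup of some verticial
subgroup of `π₁^temp(H)` at `f_V(v)` (φ2-consumers twin of `existsUnique_vertexMap_of_isQuasiGeometric`).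
[cite: MochizukiSemiAnbd2006, Cor 3.9 p.42] -/
theorem existsUnique_vertexMap_of_isQuasiGeometric_at (h37i : VerticialInjective.{u})
    (h37ii : VerticialDistinct.{u}) (h37iv𝒢 : MaximalCompactIffVerticialAt 𝒢)
    (h37ivℋ : MaximalCompactIffVerticialAt ℋ)
    (h𝒢 : 𝒢.Thm37Hypotheses) (hℋ : ℋ.Thm37Hypotheses) (c𝒢 : TemperedPiChart 𝒢)
    (cℋ : TemperedPiChart ℋ) (φ : c𝒢.G →ₜ* cℋ.G) (hφ : IsQuasiGeometric φ) :
    ∃! fV : 𝒢.graph.Vertex → ℋ.graph.Vertex,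
      ∀ (v : 𝒢.graph.Vertex) (K : Subgroup c𝒢.G), K ∈ verticialSubgroups c𝒢 v →
        ∃ K₂ ∈ verticialSubgroups cℋ (fV v), MapsOntoOpenSubgroupOf φ.toMonoidHom K K₂ := by
  obtain ⟨hmax𝒢, -⟩ := h37iv𝒢 h𝒢 c𝒢
  obtain ⟨hmaxℋ, -⟩ := h37ivℋ hℋ cℋ
  -- the image of a verticial subgroup lies, as an open subgroup, in a verticial subgroup
  have himg : ∀ (v : 𝒢.graph.Vertex) (K : Subgroup c𝒢.G), K ∈ verticialSubgroups c𝒢 v →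
      ∃ (w : ℋ.graph.Vertex) (K₂ : Subgroup cℋ.G), K₂ ∈ verticialSubgroups cℋ w ∧
        MapsOntoOpenSubgroupOf φ.toMonoidHom K K₂ := by
    intro v K hK
    obtain ⟨K₂, hK₂, hmaps⟩ := hφ.maximal K ((hmax𝒢 K).mpr ⟨v, hK⟩)
    obtain ⟨w, hK₂w⟩ := (hmaxℋ K₂).mp hK₂
    exact ⟨w, K₂, hK₂w, hmaps⟩
  -- choose, for each `v`, a verticial subgroup and the vertex of its image
  have hne : ∀ v : 𝒢.graph.Vertex, (verticialSubgroups c𝒢 v).Nonempty := fun v => (h37i 𝒢 h𝒢 c𝒢 v).1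
  choose K₀ hK₀ using hne
  choose fV K₂ hK₂ hmaps using fun v => himg v (K₀ v) (hK₀ v)
  -- any verticial subgroup at `v` goes to the same vertex
  have hall : ∀ (v : 𝒢.graph.Vertex) (K : Subgroup c𝒢.G), K ∈ verticialSubgroups c𝒢 v →
      ∃ K₂' ∈ verticialSubgroups cℋ (fV v), MapsOntoOpenSubgroupOf φ.toMonoidHom K K₂' := by
    intro v K hK
    obtain ⟨w, K₂', hK₂', hmaps'⟩ := himg v K hK
    -- `K = g K₀ g⁻¹`, so `φ(K) = φ(g) φ(K₀) φ(g)⁻¹ ≤ φ(g) K₂ φ(g)⁻¹`, verticial at `fV v`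
    obtain ⟨g, rfl⟩ := exists_conj_of_mem_verticialSubgroups c𝒢 (hK₀ v) hK
    have hle : ((K₀ v).map (MulAut.conj g).toMonoidHom).map φ.toMonoidHom ≤
        (K₂ v).map (MulAut.conj (φ g)).toMonoidHom := by
      rintro _ ⟨_, ⟨k, hk, rfl⟩, rfl⟩
      refine ⟨φ k, (hmaps v).1 ⟨k, hk, rfl⟩, ?_⟩
      change φ g * φ k * (φ g)⁻¹ = φ (g * k * g⁻¹)
      rw [map_mul, map_mul, map_inv]
    have hw : w = fV v :=
      vertex_eq_of_mapsOnto_of_le h37ii hℋ cℋ φ.toMonoidHom hK₂' (conj_mem_verticialSubgroups cℋ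
        (hK₂ v) (φ g)) hmaps' hle
    subst hw
    exact ⟨K₂', hK₂', hmaps'⟩
  refine ⟨fV, hall, fun fV' hfV' => funext fun v => ?_⟩
  obtain ⟨K₂', hK₂', hmaps'⟩ := hfV' v (K₀ v) (hK₀ v)
  exact vertex_eq_of_mapsOnto_of_le h37ii hℋ cℋ φ.toMonoidHom hK₂' (hK₂ v) hmaps' (hmaps v).1

end ProfiniteSemiGraph

end Literature.AnabelianGeometry.SemiGraphs
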